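import Summits.AtomisticToContinuum.BoseEinsteinCondensation.Theorems.BECThomsonPrincipleGDTransferSeededGradingDefs
import Summits.AtomisticToContinuum.BoseEinsteinCondensation.Theorems.BECThomsonPrincipleGDTransferSeededNearMinPhase

/-!
# Route `BECThomsonPrinciple`, crux `GDTransfer` (stmt-AtomisticToContinuum-9482), line `seeded-continuity`:
# seventh Defs file — the SPECTRAL form of the seed (lead c4): a balanced cat forces a small Ky Fan gap

`Defs` file (D-0016) continuing `…SeededDefs` (p137609), `…SeededWitnessDefs` (p139431), `…SeededRoughDefs`
(p147682), `…SeededGradingDefs`, `…SeededTransportDefs` (p153539), `…SeededIntegrableDefs` (p157332) and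
`…SeededCompactDefs` (p162740).  The registered open stub of the soft half of the line is the SEED
`stub_noBalancedCat : NoBalancedCat` — along the dilute path the `n̂₀`-law of a near-minimiser is never split
`≥ τ / ≥ τ` between `{n̂₀ < θN}` and `{n̂₀ ≥ (1−β)N}`, `τ < 1/2` chosen BEFORE `N` (its fixed-`N` form is PROVED,
`fixedNNoBalancedCat_holds`; the open content is the uniformity of `τ` in `N`, `…SeededGradingDefs`).

This file types a QUANTITATIVE cat exclusion that makes the `N`-dependence explicit and favourable, and thereby
reduces the seed (potential by potential) to a purely SPECTRAL statement — a Ky Fan gap floor of the polynomial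
size `K / L³` on the dilute path, Gaussian domination and band emptiness unused:

* SMOOTH CUT (`cutLo`, `cutHi`, `smoothBlock`): instead of cutting a state sharply at one sector `n̂₀ = j`
  (`SharpCutSplitting`, cost `C · P(band)` with `C = sup V = O(N²)`), cut it with a Lipschitz partition of unity
  `χ_lo² + χ_hi² = 1` in the variable `n̂₀/N`, ramping across the whole middle band `[θ, 1−β]` of RELATIVE width
  `w = 1−β−θ`.  Since the energy form is band-diagonal in the `n̂₀`-grading with bandwidth two
  (`KineticBlockDiagonal`, `InteractionLocality`), the IMS identity
  `𝓔(χ_loΨ) + 𝓔(χ_hiΨ) − E(Ψ) = −½ Σ_a Σ_{n≠n'} (χ_a(n/N) − χ_a(n'/N))² Re 𝓥(Ψ^{(n)}, Ψ^{(n')})` gains the factor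
  `(2·Lip/N)²`: `SmoothSplitting` — the splitting cost is `≤ 8π²/(w²N²) · D(Ψ)` with `D(Ψ) = Σ_n ∫ V|Ψ^{(n)}|²` the
  sector-PINCHED interaction (`sectorDiagV`); NO band emptiness is used.
* PINCHING BOUND (`PinchingBound`): `D(Ψ) ≤ 16 ∫V|Ψ|² + 64 ‖v‖₁ N²/L³` — pair by pair, the blocks of `Ψ^{(n)}` with
  a cell-averaged particle in the pair are flat averages worth `‖v‖₁/L³`, and the doubly-excited blocks are
  `V`-orthogonal across the sectors of the other particles; so the cost is `O(‖v‖₁/(w²L³))` UNIFORMLY IN `N`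
  (at density `ρ_L = N/L³`: `O(ρ_L‖v‖₁/N)` per state — one `N`-th of one particle's interaction energy).
* CAT ⇒ SMALL KY FAN GAP (`CatKyFan`): if a `δ`-near-minimiser carries mass `≥ τ` on both sides, the two smooth
  blocks have Gram determinant `≥ τ(1−τ)` and excess energies summing to `≤ δ + cost`, so Gram–Schmidt and
  Cauchy–Schwarz for the excess form (`cross_sq_le`) give two ORTHONORMAL trial states of total energy
  `≤ 2E₀ + (8/τ²)(δ + cost)`: `kyFanTwo − 2E₀ ≤ (8/τ²)(δ + cost)`.
* THE SPECTRAL SEED (`KyFanGapFloorFor v` ⇒ `NoBalancedCatFor v`, registered sub-goal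
  `seedFor_of_kyFanGapFloor`): a Ky Fan gap floor `kyFanTwo(N, L) − 2E₀(N, L) ≥ K/L³` along the dilute path
  (for the `K = K(θ, β, ‖v‖₁)` of the cost, `τ = 1/4`) excludes balanced cats uniformly in `N`.  Physically the floor
  is mild (the Bogoliubov phonon `≈ 4√(πaρ_L)·2π/L` and the free gap `4π²/L²` both exceed `K/L³` by powers of `N`
  on the path; at its Gross–Pitaevskii end `L = Nℓ` it is the vendored `BoccatoEtAl2019_firstGap_GP`); as a
  theorem on the thermodynamic part of the path it is open — the same wall in spectral clothing, but a standard
  object (cf. the gap cruxes `BECNudgeWalk.NudgeGap`, `BECNoCheapMomentum.SectorGapFloor`,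
  `BECRewardDescent.SectorGap` of the sibling routes), GD-free, and with no `n̂₀`-law vocabulary.

Objects: `ramp`, `cutLo`, `cutHi`, `smoothBlock`, `sectorDiagV`, `lift1`; statements `NoBalancedCatFor`,
`KyFanGapFloorFor`, `SmoothBlockAlgebra`, `SmoothSplitting`, `PinchingBound`, `CatKyFan`; sanity: the cut algebra
(`ramp_plateau`, `cutLo_sq_add_cutHi_sq`, `cutLo_of_le`, `cutHi_of_le`, `cutLo_of_ge`, `cutHi_of_ge`, the Lipschitz bounds
`abs_cutLo_sub_le`, `abs_cutHi_sub_le`, ranges), `noBalancedCatFor_of_noBalancedCat`, `noBalancedCat_of_forall`.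
Nothing open is asserted: every `def … : Prop` is consumed only as the type of a supports theorem or as a hypothesis.

References: ReedSimonIV1978 Thm XIII.1–2 (min-max, Ky Fan), §XIII.12; CyconFroeseKirschSimon1987 §3.1 (IMS
localisation); BoccatoEtAl2019Acta Thm 1.1; LSSY2005 §1.2, Ch. 5.
-/

noncomputable section

open MeasureTheory Filter
open scoped ENNReal NNReal ComplexConjugate

namespace Summit.AtomisticToContinuum.BoseEinsteinCondensation.Cruxes.GDTransfer.Seeded

open Literature.MathematicalPhysics.QuantumManyBody.BoseGas
open Summit.AtomisticToContinuum.BoseEinsteinCondensation.Theses.BECThomsonPrinciple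
open Summit.AtomisticToContinuum.BoseEinsteinCondensation.Theorems.GaussianDominationCan.Negative (modeProj)
open Summit.AtomisticToContinuum.BoseEinsteinCondensation.Cruxes.GDTransfer.DysonDressedWitness (IsDirection mass eform)

variable {m : ℕ}

/-! ## §0 Vocabulary: the smooth cut in the `n̂₀`-grading -/

/-- The unit ramp `t ↦ max 0 (min 1 t)` (1-Lipschitz, `= 0` for `t ≤ 0`, `= 1` for `t ≥ 1`). -/
def ramp (t : ℝ) : ℝ :=
  max 0 (min 1 t)

/-- The LOW cut profile `χ_lo(x) = cos(π/2 · ramp((x − θ)/(1−β−θ)))`: `= 1` for `x ≤ θ`, `= 0` for `x ≥ 1 − β`,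
Lipschitz with constant `π/(2(1−β−θ))`, and `χ_lo² + χ_hi² = 1`. -/
def cutLo (θ β x : ℝ) : ℝ :=
  Real.cos (Real.pi / 2 * ramp ((x - θ) / (1 - β - θ)))

/-- The HIGH cut profile `χ_hi(x) = sin(π/2 · ramp((x − θ)/(1−β−θ)))`: `= 0` for `x ≤ θ`, `= 1` for `x ≥ 1 − β`. -/
def cutHi (θ β x : ℝ) : ℝ :=
  Real.sin (Real.pi / 2 * ramp ((x - θ) / (1 - β - θ)))

/-- The SMOOTH BLOCK `χ(n̂₀/N)ψ = Σ_S χ(|S|/N) Q_S ψ` of `ψ` for a profile `χ` in the variable `n̂₀/N`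
(`N = m + 1`; `Q_S = modeProj`): a finite combination of the crux's mode projections. -/
def smoothBlock (m : ℕ) (L : ℝ) (χ : ℝ → ℝ) (ψ : Config (m + 1) → ℂ) : Config (m + 1) → ℂ :=
  fun X => ∑ S : Finset (Fin (m + 1)), (χ ((S.card : ℝ) / ((m : ℝ) + 1)) : ℂ) * modeProj (m + 1) L S ψ X

/-- The sector-PINCHED interaction `D(ψ) = Σ_{n=0}^{N} ∫_{cell^N} V |Ψ^{(n)}|²`, `Ψ^{(n)} = 𝟙(n̂₀ = n)ψ = Σ_{|S|=n} Q_Sψ`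
(`sectorBlock (· = n)`), `V = Σ_{i<j} v^per(xᵢ − xⱼ)`. -/
def sectorDiagV (v : ℝ → ℝ≥0∞) (m : ℕ) (L : ℝ) (ψ : Config (m + 1) → ℂ) : ℝ≥0∞ :=
  ∑ n ∈ Finset.range (m + 2),
    ∫⁻ X in cellN (m + 1) L, periodicInteraction v L X * (‖sectorBlock m L (fun i => i = n) ψ X‖₊ : ℝ≥0∞) ^ 2

/-- `‖v‖₁ = ∫_{ℝ³} v(|x|) dx` as a real number (finite for finite continuous finite-range profiles). -/
def lift1 (v : ℝ → ℝ≥0∞) : ℝ :=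
  (∫⁻ x : Space, v ‖x‖).toReal

/-! ## §1 The seed and the gap floor, potential by potential -/

/-- THE SEED AT ONE POTENTIAL: the body of `NoBalancedCat` (in its `loMass`/`hiMass` reading `noBalancedCat_iff`) after
`∀ v, IsRepulsiveFiniteRange v →`. -/
def NoBalancedCatFor (v : ℝ → ℝ≥0∞) : Prop :=
  ∀ θ β : ℝ, 0 < θ → 0 < β → θ + β < 1 →
    ∃ τ : ℝ, 0 < τ ∧ τ < 1 / 2 ∧ ∃ ρ₀ : ℝ, 0 < ρ₀ ∧ ∃ N₀ : ℕ, ∀ m : ℕ, N₀ ≤ m + 1 → ∀ L : ℝ, 0 < L →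
      ((m + 1 : ℕ) : ℝ) ≤ ρ₀ * L ^ 3 → periodicGroundStateEnergy v (m + 1) L ≠ ⊤ →
      ∃ δ : ℝ≥0∞, 0 < δ ∧ ∀ Ψ : PeriodicTrialState (m + 1) L,
        periodicEnergy v Ψ ≤ periodicGroundStateEnergy v (m + 1) L + δ →
        ¬ (ENNReal.ofReal τ ≤ loMass m L θ Ψ.ψ ∧ ENNReal.ofReal τ ≤ hiMass m L β Ψ.ψ)

/-- THE KY FAN GAP FLOOR AT ONE POTENTIAL (the spectral form of the seed): for every `K > 0`, along the dilute path
(`N ≥ N₀`, `N ≤ ρ₀L³`) the sum of the two lowest levels exceeds twice the ground-state energy by at least `K/L³`: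
`2E₀(N, L) + K/L³ ≤ kyFanTwo(N, L)` (`kyFanTwo` = infimum of `E(Φ₁) + E(Φ₂)` over `L²(cell^N)`-orthogonal periodic
trial states = `θ₁ + θ₂`).  Far below the Bogoliubov phonon `≈ 8π√(πaρ_L)/L` and the free gap `4π²/L²` on the path;
at the GP end `L = Nℓ` the vendored `BoccatoEtAl2019_firstGap_GP`; open on the thermodynamic part. -/
def KyFanGapFloorFor (v : ℝ → ℝ≥0∞) : Prop :=
  ∀ K : ℝ, 0 < K → ∃ ρ₀ : ℝ, 0 < ρ₀ ∧ ∃ N₀ : ℕ, ∀ m : ℕ, N₀ ≤ m + 1 → ∀ L : ℝ, 0 < L →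
    ((m + 1 : ℕ) : ℝ) ≤ ρ₀ * L ^ 3 →
    2 * periodicGroundStateEnergy v (m + 1) L + ENNReal.ofReal (K / L ^ 3) ≤ kyFanTwo v (m + 1) L

/-! ## §2 The statements of the quantitative cat exclusion -/

/-- ALGEBRA OF THE TWO SMOOTH BLOCKS `f = χ_lo(n̂₀/N)Ψ`, `g = χ_hi(n̂₀/N)Ψ` of a periodic trial state (band parameters
`θ, β`): both are directions; their masses and their (real) inner product are the `χ_lo²`-, `χ_hi²`- and
`χ_loχ_hi`-weighted sums of the component masses `w_S = compMass S` (Pythagoras over the orthogonal `Q_SΨ`,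
`Lnss.integral_norm_sq_sum_modeProj`, `Lnss.integral_conj_modeProj_mul_modeProj`); the masses add up to `1`. -/
def SmoothBlockAlgebra : Prop :=
  ∀ (m : ℕ) (L : ℝ), 0 < L → ∀ θ β : ℝ, 0 < θ → 0 < β → θ + β < 1 → ∀ Ψ : PeriodicTrialState (m + 1) L,
    IsDirection m L (smoothBlock m L (cutLo θ β) Ψ.ψ) ∧ IsDirection m L (smoothBlock m L (cutHi θ β) Ψ.ψ) ∧
    mass L (smoothBlock m L (cutLo θ β) Ψ.ψ) + mass L (smoothBlock m L (cutHi θ β) Ψ.ψ) = 1 ∧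
    (mass L (smoothBlock m L (cutLo θ β) Ψ.ψ)).toReal =
      ∑ S : Finset (Fin (m + 1)), cutLo θ β ((S.card : ℝ) / ((m : ℝ) + 1)) ^ 2 * (compMass m L S Ψ.ψ).toReal ∧
    (mass L (smoothBlock m L (cutHi θ β) Ψ.ψ)).toReal =
      ∑ S : Finset (Fin (m + 1)), cutHi θ β ((S.card : ℝ) / ((m : ℝ) + 1)) ^ 2 * (compMass m L S Ψ.ψ).toReal ∧
    (∫ X in cellN (m + 1) L, conj (smoothBlock m L (cutLo θ β) Ψ.ψ X) * smoothBlock m L (cutHi θ β) Ψ.ψ X) =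
      ((∑ S : Finset (Fin (m + 1)), cutLo θ β ((S.card : ℝ) / ((m : ℝ) + 1)) *
          cutHi θ β ((S.card : ℝ) / ((m : ℝ) + 1)) * (compMass m L S Ψ.ψ).toReal : ℝ) : ℂ)

/-- THE SMOOTH SPLITTING INEQUALITY (finite continuous profiles): cutting a periodic trial state with the Lipschitz
partition of unity `χ_lo² + χ_hi² = 1` across the middle band costs at most `8π²/((1−β−θ)²N²)` times the
sector-pinched interaction — the IMS identity in the band-diagonal `n̂₀`-grading (`KineticBlockDiagonal`: no kinetic
cross terms; `InteractionLocality`: only `|n − n'| ≤ 2` talk; Cauchy–Schwarz for the weighted form; the Lipschitz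
bound `|χ(n/N) − χ(n'/N)| ≤ π|n − n'|/(2(1−β−θ)N)`).  No band emptiness is used. -/
def SmoothSplitting : Prop :=
  ∀ v : ℝ → ℝ≥0∞, IsRepulsiveFiniteRange v → IsFiniteContinuous v →
    ∀ (m : ℕ) (L : ℝ), 0 < L → ∀ θ β : ℝ, 0 < θ → 0 < β → θ + β < 1 → ∀ Ψ : PeriodicTrialState (m + 1) L,
      eform v L (smoothBlock m L (cutLo θ β) Ψ.ψ) + eform v L (smoothBlock m L (cutHi θ β) Ψ.ψ) ≤
        periodicEnergy v Ψ +
          ENNReal.ofReal (8 * Real.pi ^ 2 / ((1 - β - θ) ^ 2 * (((m : ℝ) + 1) ^ 2))) * sectorDiagV v m L Ψ.ψ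

/-- THE PINCHING BOUND (finite continuous profiles): the sector-pinched interaction of a periodic trial state is at most
`16 ∫V|Ψ|² + 64‖v‖₁N²/L³` — pair by pair `{p, q}`: split `Ψ^{(n)}` by the four idempotents `P_pP_q`, `P_p(1−P_q)`,
`(1−P_p)P_q`, `(1−P_p)(1−P_q)`; a block with a flat (cell-averaged) particle of the pair has pair energy
`(‖v‖₁/L³)·mass ≤ ‖v‖₁/L³` (first-particle integration of `v^per`), and the doubly-excited blocks
`(1−P_p)(1−P_q)Ψ^{(n)} = Σ_{|S|=n, p,q∉S} Q_SΨ` are `v^per(x_p−x_q)`-ORTHOGONAL across `n` (a slot of the other particles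
separates the sectors and the pair weight is flat there), so they sum to `∫v^per(x_p−x_q)|(1−P_p)(1−P_q)Ψ|² ≤
4(∫v^per(x_p−x_q)|Ψ|² + 3‖v‖₁/L³)`. -/
def PinchingBound : Prop :=
  ∀ v : ℝ → ℝ≥0∞, IsRepulsiveFiniteRange v → IsFiniteContinuous v →
    ∀ (m : ℕ) (L : ℝ), 0 < L → ∀ Ψ : PeriodicTrialState (m + 1) L,
      sectorDiagV v m L Ψ.ψ ≤
        16 * (∫⁻ X in cellN (m + 1) L, periodicInteraction v L X * (‖Ψ.ψ X‖₊ : ℝ≥0∞) ^ 2) +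
          ENNReal.ofReal (64 * lift1 v * ((m : ℝ) + 1) ^ 2 / L ^ 3)

/-- A BALANCED CAT FORCES A SMALL KY FAN GAP (abstract in the splitting cost `Δ`): if the two smooth blocks of a
periodic trial state have finite energy forms summing to `≤ E₀ + Δ` while both sides carry mass `≥ τ`
(`0 < τ ≤ 1/2`), then `kyFanTwo ≤ 2E₀ + (8/τ²)Δ` — Gram determinant `≥ τ(1−τ)` from the block algebra and
Cauchy–Schwarz on the transition zone, Gram–Schmidt to an orthonormal pair of trial states (`PeriodicTrialState.ofFun`),
Cauchy–Schwarz for the excess form (`cross_sq_le`), the variational definition of `kyFanTwo`. -/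
def CatKyFan : Prop :=
  SmoothBlockAlgebra → ∀ v : ℝ → ℝ≥0∞, Measurable v → ∀ (m : ℕ) (L : ℝ), 0 < L →
    periodicGroundStateEnergy v (m + 1) L ≠ ⊤ → ∀ θ β : ℝ, 0 < θ → 0 < β → θ + β < 1 →
    ∀ τ : ℝ, 0 < τ → τ ≤ 1 / 2 → ∀ (Ψ : PeriodicTrialState (m + 1) L) (Δ : ℝ≥0∞),
      eform v L (smoothBlock m L (cutLo θ β) Ψ.ψ) ≠ ⊤ → eform v L (smoothBlock m L (cutHi θ β) Ψ.ψ) ≠ ⊤ →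
      eform v L (smoothBlock m L (cutLo θ β) Ψ.ψ) + eform v L (smoothBlock m L (cutHi θ β) Ψ.ψ) ≤
        periodicGroundStateEnergy v (m + 1) L + Δ →
      ENNReal.ofReal τ ≤ loMass m L θ Ψ.ψ → ENNReal.ofReal τ ≤ hiMass m L β Ψ.ψ →
      kyFanTwo v (m + 1) L ≤ 2 * periodicGroundStateEnergy v (m + 1) L + ENNReal.ofReal (8 / τ ^ 2) * Δ

/-! ## §3 Sanity (sorry-free): the cut algebra and the dictionary with the registered seed -/

/-- `0 ≤ ramp t ≤ 1`. -/
theorem ramp_mem_Icc (t : ℝ) : ramp t ∈ Set.Icc (0 : ℝ) 1 :=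
  ⟨le_max_left _ _, max_le zero_le_one (min_le_left _ _)⟩

/-- The two plateaux of the ramp: `ramp t = 0` for `t ≤ 0` and `ramp t = 1` for `1 ≤ t` (one statement, to be
used through `.1` / `.2`). -/
theorem ramp_plateau (t : ℝ) : (t ≤ 0 → ramp t = 0) ∧ (1 ≤ t → ramp t = 1) := by
  unfold ramp
  exact ⟨fun ht => max_eq_left ((min_le_right _ _).trans ht),
    fun ht => by rw [min_eq_left ht, max_eq_right zero_le_one]⟩

/-- The ramp is 1-Lipschitz. -/
theorem abs_ramp_sub_ramp_le (s t : ℝ) : |ramp s - ramp t| ≤ |s - t| := by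
  unfold ramp
  have h1 : |min 1 s - min 1 t| ≤ |s - t| := abs_min_sub_min_le_max _ _ _ _ |>.trans (by
    rw [sub_self, abs_zero, max_eq_right (abs_nonneg _)])
  exact (abs_max_sub_max_le_max _ _ _ _).trans (by
    rw [sub_self, abs_zero, max_eq_right (abs_nonneg _)]; exact h1)

/-- **The partition of unity**: `χ_lo² + χ_hi² = 1`. -/
theorem cutLo_sq_add_cutHi_sq (θ β x : ℝ) : cutLo θ β x ^ 2 + cutHi θ β x ^ 2 = 1 := by
  unfold cutLo cutHi
  rw [Real.cos_sq_add_sin_sq]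

/-- `0 ≤ χ_lo ≤ 1` (the argument lies in `[0, π/2]`). -/
theorem cutLo_mem_Icc (θ β x : ℝ) : cutLo θ β x ∈ Set.Icc (0 : ℝ) 1 := by
  unfold cutLo
  have hr := ramp_mem_Icc ((x - θ) / (1 - β - θ))
  refine ⟨Real.cos_nonneg_of_mem_Icc ⟨?_, ?_⟩, Real.cos_le_one _⟩
  · nlinarith [Real.pi_pos, hr.1]
  · nlinarith [Real.pi_pos, hr.2]

/-- `0 ≤ χ_hi ≤ 1`. -/
theorem cutHi_mem_Icc (θ β x : ℝ) : cutHi θ β x ∈ Set.Icc (0 : ℝ) 1 := by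
  unfold cutHi
  have hr := ramp_mem_Icc ((x - θ) / (1 - β - θ))
  refine ⟨Real.sin_nonneg_of_nonneg_of_le_pi ?_ ?_, Real.sin_le_one _⟩
  · nlinarith [Real.pi_pos, hr.1]
  · nlinarith [Real.pi_pos, hr.2]

/-- Below the band the low cut is `1` … -/
theorem cutLo_of_le {θ β x : ℝ} (hw : 0 < 1 - β - θ) (hx : x ≤ θ) : cutLo θ β x = 1 := by
  unfold cutLo
  rw [(ramp_plateau _).1 (div_nonpos_of_nonpos_of_nonneg (by linarith) hw.le), mul_zero, Real.cos_zero]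

/-- … and the high cut is `0`. -/
theorem cutHi_of_le {θ β x : ℝ} (hw : 0 < 1 - β - θ) (hx : x ≤ θ) : cutHi θ β x = 0 := by
  unfold cutHi
  rw [(ramp_plateau _).1 (div_nonpos_of_nonpos_of_nonneg (by linarith) hw.le), mul_zero, Real.sin_zero]

/-- Above the band the low cut is `0` … -/
theorem cutLo_of_ge {θ β x : ℝ} (hw : 0 < 1 - β - θ) (hx : 1 - β ≤ x) : cutLo θ β x = 0 := by
  unfold cutLo
  rw [(ramp_plateau _).2 ((one_le_div hw).2 (by linarith)), mul_one, Real.cos_pi_div_two]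

/-- … and the high cut is `1`. -/
theorem cutHi_of_ge {θ β x : ℝ} (hw : 0 < 1 - β - θ) (hx : 1 - β ≤ x) : cutHi θ β x = 1 := by
  unfold cutHi
  rw [(ramp_plateau _).2 ((one_le_div hw).2 (by linarith)), mul_one, Real.sin_pi_div_two]

/-- **Lipschitz bound for the low cut**: `|χ_lo(x) − χ_lo(y)| ≤ (π/2)|x − y|/(1−β−θ)`. -/
theorem abs_cutLo_sub_le {θ β : ℝ} (hw : 0 < 1 - β - θ) (x y : ℝ) :
    |cutLo θ β x - cutLo θ β y| ≤ Real.pi / 2 * |x - y| / (1 - β - θ) := by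
  unfold cutLo
  refine (Real.abs_cos_sub_cos_le _ _).trans ?_
  rw [← mul_sub, abs_mul, abs_of_pos (by positivity : (0 : ℝ) < Real.pi / 2), mul_div_assoc]
  refine mul_le_mul_of_nonneg_left ((abs_ramp_sub_ramp_le _ _).trans ?_) (by positivity)
  rw [← sub_div, abs_div, abs_of_pos hw]
  exact div_le_div_of_nonneg_right (le_of_eq (by ring_nf)) hw.le

/-- **Lipschitz bound for the high cut**: `|χ_hi(x) − χ_hi(y)| ≤ (π/2)|x − y|/(1−β−θ)`. -/
theorem abs_cutHi_sub_le {θ β : ℝ} (hw : 0 < 1 - β - θ) (x y : ℝ) :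
    |cutHi θ β x - cutHi θ β y| ≤ Real.pi / 2 * |x - y| / (1 - β - θ) := by
  unfold cutHi
  refine (Real.abs_sin_sub_sin_le _ _).trans ?_
  rw [← mul_sub, abs_mul, abs_of_pos (by positivity : (0 : ℝ) < Real.pi / 2), mul_div_assoc]
  refine mul_le_mul_of_nonneg_left ((abs_ramp_sub_ramp_le _ _).trans ?_) (by positivity)
  rw [← sub_div, abs_div, abs_of_pos hw]
  exact div_le_div_of_nonneg_right (le_of_eq (by ring_nf)) hw.le

/-- The registered seed gives the seed at every admissible potential (`noBalancedCat_iff` is `Iff.rfl`). -/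
theorem noBalancedCatFor_of_noBalancedCat (h : NoBalancedCat) (v : ℝ → ℝ≥0∞) (hv : IsRepulsiveFiniteRange v) :
    NoBalancedCatFor v :=
  (noBalancedCat_iff.mp h) v hv

/-- Conversely the seed at every admissible potential is the registered seed. -/
theorem noBalancedCat_of_forall : (∀ v : ℝ → ℝ≥0∞, IsRepulsiveFiniteRange v → NoBalancedCatFor v) → NoBalancedCat :=
  fun h => noBalancedCat_iff.mpr h

end Summit.AtomisticToContinuum.BoseEinsteinCondensation.Cruxes.GDTransfer.Seeded

end
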